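import Summits.HodgeConjecture.HodgeConjecture.Theses.MilnorKExponential
import Summits.HodgeConjecture.HodgeConjecture.Theorems.MilnorKExponentialSymbolLiftRWeightOneModel
import Summits.HodgeConjecture.HodgeConjecture.Theorems.MilnorKExponentialSymbolLiftRPowerNormalisation
import Summits.HodgeConjecture.HodgeConjecture.Theorems.MilnorKExponentialSymbolLiftRCupStep
import Summits.HodgeConjecture.HodgeConjecture.Theorems.MilnorKExponentialSymbolLiftRAdd
import Literature.AlgebraicGeometry.HodgeTheory.HardLefschetzNFoldHolds
import Literature.AlgebraicGeometry.HodgeTheory.HodgeSectionRestrictionPairing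
import Literature.AlgebraicGeometry.HodgeTheory.HodgeFiltrationModelsReductionProofs
import HarnessLib

/-!
# `SymbolLiftR` (LIFT_p) reduced to its primitive kernel; LIFT unconditionally in weight one and in dimension `≤ 3`

Theorems file of route `MilnorKExponential` of the Hodge summit, crux `SymbolLiftR`
(stmt-HodgeConjecture-18702: every rational class of Hodge type `(q+1,q+1)` on a smooth projective
complex `n`-fold, `q + 1 ≤ n`, is a Milnor SYMBOL class of weight `q + 1` on a symbol-normalised Hodge
model), line `lefschetz-fold` of the crux protocol.

The four "known mathematics" stubs of the line are landed theorems of this namespace: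
`stub_weightOneModel` (S1: on every smooth projective `X`, `n ≥ 1`, the Hodge model whose de Rham
comparison is de Rham's INTEGRATION comparison complexified and rescaled by `(2πi)^{-k/2}` carries a
weight-one symbol cocycle for every rational `(1,1)` class — Lefschetz `(1,1)` in symbol form),
`stub_powerNormalisation` (S2: that model is symbol-normalised in every degree `2(q+1) ≤ 2n`, by the
cup powers of the transition cocycle of a holomorphic line bundle), `stub_cupStep` (S3: on it the
Lefschetz operator `h ∪ ·` carries weight-`(q+1)` symbol cocycles to weight-`(q+2)` ones — Čech cup
product of Milnor cocycles, multiplicativity of the zig-zag and of integration) and `stub_add` (S4: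
symbol cocycles on one model add). This file assembles them:

* `hasSymbolCocycle_of_primitiveLiftAt` — **the Lefschetz fold on one model**: on a rescaled
  integration model `A` of `X` carrying the weight-one cocycles, IF every primitive rational
  `(q+2,q+2)` class with `2(q+2) ≤ n` has a weight-`(q+2)` symbol cocycle on `A` (the kernel, as a
  hypothesis about this `X`, `Λ`, `A` only), THEN every rational `(q+1,q+1)` class with `q + 1 ≤ n`
  has a weight-`(q+1)` symbol cocycle on `A` (induction on the weight: hard Lefschetz
  `nonempty_hardLefschetzNFold_holds`, the Lefschetz peel
  `HardLefschetzNFold.exists_eq_primitive_add_lefschetzOperator`, `exists_hdg_preimage` above the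
  middle, `hodgePQ_independent_of_hodgeModel_holds`, S3 and S4);
* `symbolLiftR_of_primitiveLift` — **the crux follows from its primitive kernel** (stub S5 of the
  line, stated unfolded as the hypothesis; first open case `(n,p) = (4,2)`: primitive rational
  `(2,2)` classes on fourfolds);
* `symbolLiftR_weightOne` — **LIFT₁ unconditionally**: every rational `(1,1)` class on a smooth
  projective `n`-fold, `n ≥ 1`, is a symbol class of weight one on a symbol-normalised model
  (= the crux at `q = 0`; Lefschetz `(1,1)` + the exponential sequence, in the route's typing);
* `symbolLiftR_of_dim_le_three` — **the crux unconditionally for `n ≤ 3`** (no primitive class of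
  weight `≥ 2` lies in the lower half);
* `normalisedModelsExist` — **symbol-normalised Hodge models exist in every degree `2(q+1) ≤ 2n`**
  (the refuter's typing test "ℙ¹, `p = 1`, `c = h`" of the crux attack, settled positively).

References: R. Bott, L. W. Tu, *Differential Forms in Algebraic Topology* (1982), §8 Prop. 8.8, §9;
C. Voisin, *Hodge Theory and Complex Algebraic Geometry I* (2002), Thm. 6.25, Thm. 7.10, Thm. 11.30;
H. Esnault, *A note on the cycle map*, J. reine angew. Math. 411 (1990), §3.
-/

noncomputable section

-- The mandated namespace repeats `HodgeConjecture` (single-conjunct summit).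
set_option linter.dupNamespace false

open scoped Manifold ContDiff

namespace Summit.HodgeConjecture.HodgeConjecture.Theorems.SymbolLiftR

open Literature.AlgebraicGeometry Literature.AlgebraicGeometry.HodgeTheory
open Literature.Geometry.Kaehler Literature.NumberTheory.Transcendental
open Summit.HodgeConjecture.HodgeConjecture.Theses.MilnorKExponential (SymbolLiftR)

variable {n : ℕ} {X : Motives.SchemeOver ℂ}

/-- **The Lefschetz fold on one model.** Let `A` be a Hodge model of the smooth projective `n`-fold
`X` whose comparison is the `(2πi)^{-k/2}`-rescaled integration comparison (`hA`) and which carries a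
weight-one symbol cocycle for every rational `(1,1)` class (`hone`), and let `Λ` be a hard-Lefschetz
datum. If every PRIMITIVE rational `(q+2,q+2)` class with `2(q+2) ≤ n` has a weight-`(q+2)` symbol
cocycle on `A` (`h4`), then every rational class of type `(q+1,q+1)`, `q + 1 ≤ n`, has a
weight-`(q+1)` symbol cocycle on `A`. Induction on the weight: in weight `q + 2`, if
`2(q+1) + 1 ≤ n` the Lefschetz peel `HardLefschetzNFold.exists_eq_primitive_add_lefschetzOperator`
writes `c = x₀ + h ∪ β` with `β` rational `(q+1,q+1)` (induction + `stub_cupStep`) and `x₀` primitive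
rational `(q+2,q+2)` (`h4`, or `x₀ = L⁰ x₀ = 0` when `2(q+2) = n + 1`), summed by `stub_add`; above
that range hard Lefschetz (`exists_hdg_preimage`) writes `c = h ∪ c'` and `stub_cupStep` applies to
the induction hypothesis. [cite: VoisinHodgeI2002, Thm. 6.25 and Rem. 6.27] -/
theorem hasSymbolCocycle_of_primitiveLiftAt (hX : Motives.IsSmoothProjective n X)
    (Λ : HardLefschetzNFold n X) (A : HodgeModel n X)
    (hA : ∀ (k : ℕ) (y : complexDeRhamCohomology A.model A.carrier k),
      A.deRham A.carrier k y = ((2 * (Real.pi : ℂ) * Complex.I) ^ (k / 2))⁻¹ •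
        (integrationDeRhamIsoFamily A.model).complexify A.carrier k y)
    (hone : ∀ c : complexBetti X (2 * (0 + 1)), IsRationalClass c →
      IsOfHodgeType n X (2 * (0 + 1)) (0 + 1) (0 + 1) c → A.HasSymbolCocycle 0 c)
    (h4 : ∀ (q : ℕ), 2 * (q + 2) ≤ n →
      ∀ (c : complexBetti X (2 * (q + 1 + 1))), IsRationalClass c →
        IsOfHodgeType n X (2 * (q + 1 + 1)) (q + 1 + 1) (q + 1 + 1) c →
        (∃ (j t : ℕ) (ht : 2 * (q + 1 + 1) + 2 * j = t),
            2 * (q + 1 + 1) + j = n + 1 ∧ Λ.L j (2 * (q + 1 + 1)) t ht c = 0) →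
          A.HasSymbolCocycle (q + 1) c) :
    ∀ q : ℕ, q + 1 ≤ n → ∀ c : complexBetti X (2 * (q + 1)), IsRationalClass c →
      IsOfHodgeType n X (2 * (q + 1)) (q + 1) (q + 1) c → A.HasSymbolCocycle q c := by
  have hI : hodgePQ_independent_of_hodgeModel := hodgePQ_independent_of_hodgeModel_holds
  intro q
  induction q with
  | zero =>
    intro _ c hc hpp
    exact hone c hc hpp
  | succ q ih =>
    intro hq c hc hpp
    by_cases hlow : 2 * (q + 1) + 1 ≤ n
    · -- (a) the Lefschetz peel `c = x₀ + h ∪ β`, `x₀` primitive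
      obtain ⟨j, hj⟩ : ∃ j : ℕ, 2 * (q + 1) + (j + 1) = n :=
        ⟨n - (2 * (q + 1) + 1), by omega⟩
      obtain ⟨x₀, β, hx, hprim, hrat, htyp⟩ :=
        Λ.exists_eq_primitive_add_lefschetzOperator hj (two_add_two_mul (q + 1)) rfl c
      obtain ⟨hx₀Q, hβQ⟩ := hrat hc
      have hcA : A.pullback (2 * (q + 1 + 1)) c ∈
          A.hodgePQ (2 * (q + 1 + 1)) (q + 1 + 1) (q + 1 + 1) :=
        (hI.isOfHodgeType_iff hX A).1 hpp
      obtain ⟨hx₀A, hβA⟩ := htyp A (q + 1) (q + 1) hI hX hcA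
      have hβT : IsOfHodgeType n X (2 * (q + 1)) (q + 1) (q + 1) β := ⟨A, hβA⟩
      have hx₀T : IsOfHodgeType n X (2 * (q + 1 + 1)) (q + 1 + 1) (q + 1 + 1) x₀ := ⟨A, hx₀A⟩
      have hβS : A.HasSymbolCocycle q β := ih (by omega) β hβQ hβT
      have hLβS : A.HasSymbolCocycle (q + 1)
          (lefschetzOperator Λ.hyperplaneClass (two_add_two_mul (q + 1)) β) :=
        stub_cupStep hX Λ A hA hone q β (by omega) hβS
      have hx₀S : A.HasSymbolCocycle (q + 1) x₀ := by
        by_cases hmid : 2 * (q + 2) ≤ n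
        · exact h4 q hmid x₀ hx₀Q hx₀T ⟨j, _, rfl, by omega, hprim⟩
        · -- `2(q+2) = n + 1`: `j = 0` and `x₀ = L⁰ x₀ = 0`
          obtain rfl : j = 0 := by omega
          have hx₀0 : x₀ = 0 := hprim
          rw [hx₀0]
          exact A.hasSymbolCocycle_zero (q + 1)
      rw [hx]
      exact stub_add A (q + 1) x₀ _ hx₀S hLβS
    · -- (b) above the peel range: `c = h ∪ c'` by hard Lefschetz
      obtain ⟨e, he⟩ : ∃ e : ℕ, e + (q + 2) = n := ⟨n - (q + 2), by omega⟩
      obtain ⟨d, hd⟩ : ∃ d : ℕ, n + (d + 1) = 2 * (q + 2) := ⟨2 * (q + 2) - n - 1, by omega⟩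
      have hjk : 2 * e + (d + 1) = n := by omega
      have hm : 2 * e + 2 * (d + 1) = 2 * (q + 1 + 1) := by omega
      have hpp' : IsOfHodgeType n X (2 * (q + 1 + 1)) (e + (d + 1)) (e + (d + 1)) c := by
        have hed : e + (d + 1) = q + 1 + 1 := by omega
        rw [hed]
        exact hpp
      obtain ⟨c', hc'Q, hc'T, hcc'⟩ :=
        Λ.exists_hdg_preimage hjk (2 * (q + 1 + 1)) hm e e c hc hpp'
      have hm' : 2 * e + 2 * d = 2 * (q + 1) := by omega
      -- `c'' = L^d c'`, rational of type `(q+1, q+1)`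
      have hc''Q : IsRationalClass (Λ.L d (2 * e) (2 * (q + 1)) hm' c') :=
        Λ.isRationalClass_L d (2 * e) (2 * (q + 1)) hm' hc'Q
      have hc''T : IsOfHodgeType n X (2 * (q + 1)) (q + 1) (q + 1)
          (Λ.L d (2 * e) (2 * (q + 1)) hm' c') := by
        have hed : e + d = q + 1 := by omega
        have h := Λ.isOfHodgeType_L d (2 * e) (2 * (q + 1)) hm' e e hc'T
        rw [hed] at h
        exact h
      have hc''S : A.HasSymbolCocycle q (Λ.L d (2 * e) (2 * (q + 1)) hm' c') :=
        ih (by omega) _ hc''Q hc''T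
      have key : c = lefschetzOperator Λ.hyperplaneClass (two_add_two_mul (q + 1))
          (Λ.L d (2 * e) (2 * (q + 1)) hm' c') := by
        rw [← hcc']
        exact lefschetzPowTo_succ_apply Λ.hyperplaneClass d (2 * e) (2 * (q + 1))
          (2 * (q + 1 + 1)) hm' hm (two_add_two_mul (q + 1)) c'
      rw [key]
      exact stub_cupStep hX Λ A hA hone q _ (by omega) hc''S

/-- **`SymbolLiftR` follows from its primitive kernel** (stub S5 of line `lefschetz-fold`, stated
unfolded): if, on every smooth projective `X` with hard-Lefschetz datum `Λ` and every Hodge model `A`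
with rescaled integration comparison carrying the weight-one cocycles, every primitive rational
`(q+2,q+2)` class with `2(q+2) ≤ n` has a weight-`(q+2)` symbol cocycle on `A`, then the crux
`SymbolLiftR` holds. The model is `stub_weightOneModel`'s, its normalisation is
`stub_powerNormalisation`, the cocycle is `hasSymbolCocycle_of_primitiveLiftAt`; the regrouping
between the named vocabulary (`IsSymbolNormalized`, `HasSymbolCocycle`, `IsMilnorSymbolCocycle`) and
the inlined text of the route decl is definitional. First open instance of the hypothesis:
`(n, p) = (4, 2)` (primitive rational `(2,2)` classes on fourfolds). [cite: VoisinHodgeI2002, Thm. 6.25 and Thm. 11.30] -/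
theorem symbolLiftR_of_primitiveLift
    (h4 : ∀ ⦃n : ℕ⦄ ⦃X : Motives.SchemeOver ℂ⦄, Motives.IsSmoothProjective n X →
      ∀ (Λ : HardLefschetzNFold n X) (A : HodgeModel n X),
        (∀ (k : ℕ) (y : complexDeRhamCohomology A.model A.carrier k),
          A.deRham A.carrier k y = ((2 * (Real.pi : ℂ) * Complex.I) ^ (k / 2))⁻¹ •
            (integrationDeRhamIsoFamily A.model).complexify A.carrier k y) →
        (∀ c : complexBetti X (2 * (0 + 1)), IsRationalClass c →
          IsOfHodgeType n X (2 * (0 + 1)) (0 + 1) (0 + 1) c → A.HasSymbolCocycle 0 c) →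
        ∀ (q : ℕ), 2 * (q + 2) ≤ n →
          ∀ (c : complexBetti X (2 * (q + 1 + 1))), IsRationalClass c →
            IsOfHodgeType n X (2 * (q + 1 + 1)) (q + 1 + 1) (q + 1 + 1) c →
            (∃ (j t : ℕ) (ht : 2 * (q + 1 + 1) + 2 * j = t),
                2 * (q + 1 + 1) + j = n + 1 ∧ Λ.L j (2 * (q + 1 + 1)) t ht c = 0) →
              A.HasSymbolCocycle (q + 1) c) :
    SymbolLiftR := by
  intro n X hX q hq c hc hpp
  obtain ⟨Λ⟩ := nonempty_hardLefschetzNFold_holds n X hX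
  obtain ⟨A, hA, hone⟩ := stub_weightOneModel hX (by omega)
  have hN : A.IsSymbolNormalized q := stub_powerNormalisation hX A hA q hq
  have hS : A.HasSymbolCocycle q c :=
    hasSymbolCocycle_of_primitiveLiftAt hX Λ A hA hone (h4 hX Λ A hA hone) q hq c hc hpp
  refine ⟨A, ?_, ?_⟩
  · obtain ⟨ι, hι, L, θ₀, c₀, hT, hr, hne, hde⟩ := hN
    exact ⟨ι, hι, L, θ₀, c₀, hT, hr, hne, hde⟩
  · obtain ⟨ι, hι, U, hU, hcov, σ, hσ, θ, m, hm, hT, hde⟩ := hS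
    exact ⟨ι, hι, U, hU, hcov, σ, hσ.1, hσ.2, θ, m, hm, hT, hde⟩

/-- **LIFT₁ unconditionally (Lefschetz `(1,1)` in symbol form).** On a smooth projective complex
`n`-fold, `n ≥ 1`, every rational class of Hodge type `(1,1)` is a symbol class of weight one on a
symbol-normalised Hodge model: `∃ A, A.IsSymbolNormalized 0 ∧ A.HasSymbolCocycle 0 c` — the crux
`SymbolLiftR` at `q = 0`, from `stub_weightOneModel` and `stub_powerNormalisation`.
[cite: VoisinHodgeI2002, Thm. 11.30 and Thm. 7.10] -/
theorem symbolLiftR_weightOne (hX : Motives.IsSmoothProjective n X) (hn : 1 ≤ n)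
    (c : complexBetti X (2 * (0 + 1))) (hc : IsRationalClass c)
    (hpp : IsOfHodgeType n X (2 * (0 + 1)) (0 + 1) (0 + 1) c) :
    ∃ A : HodgeModel n X, A.IsSymbolNormalized 0 ∧ A.HasSymbolCocycle 0 c := by
  obtain ⟨A, hA, hone⟩ := stub_weightOneModel hX hn
  exact ⟨A, stub_powerNormalisation hX A hA 0 hn, hone c hc hpp⟩

/-- **The crux `SymbolLiftR` unconditionally in dimension `≤ 3`**: for `X` smooth projective of
dimension `n ≤ 3`, every rational class of Hodge type `(q+1,q+1)`, `q + 1 ≤ n`, is a symbol class of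
weight `q + 1` on a symbol-normalised Hodge model. The fold never meets a primitive class of weight
`≥ 2` in the lower half (`2(q+2) ≤ n ≤ 3` is empty), so the kernel hypothesis of
`hasSymbolCocycle_of_primitiveLiftAt` is vacuous. [cite: VoisinHodgeII2003, §10.2.3 proof of Prop. 10.26] -/
theorem symbolLiftR_of_dim_le_three (hX : Motives.IsSmoothProjective n X) (hn3 : n ≤ 3)
    (q : ℕ) (hq : q + 1 ≤ n) (c : complexBetti X (2 * (q + 1))) (hc : IsRationalClass c)
    (hpp : IsOfHodgeType n X (2 * (q + 1)) (q + 1) (q + 1) c) :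
    ∃ A : HodgeModel n X, A.IsSymbolNormalized q ∧ A.HasSymbolCocycle q c := by
  obtain ⟨Λ⟩ := nonempty_hardLefschetzNFold_holds n X hX
  obtain ⟨A, hA, hone⟩ := stub_weightOneModel hX (by omega)
  refine ⟨A, stub_powerNormalisation hX A hA q hq, ?_⟩
  refine hasSymbolCocycle_of_primitiveLiftAt hX Λ A hA hone (fun q' hq' ↦ ?_) q hq c hc hpp
  omega

/-- **Symbol-normalised Hodge models exist in every degree `2(q+1) ≤ 2 dim X`** (the typing test of
the crux attack — "the normalisation/`Tr` clause must be satisfiable inside the dimension, next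
falsifier ℙ¹, `p = 1`, `c = h`" — settled positively): for `X` smooth projective of dimension `n` and
`q + 1 ≤ n` there is a Hodge model `A` with `A.IsSymbolNormalized q` (the rescaled integration model
of `stub_weightOneModel`, normalised by `stub_powerNormalisation`).
[cite: VoisinHodgeI2002, Thm. 7.10 (proof)] -/
theorem normalisedModelsExist (hX : Motives.IsSmoothProjective n X) (q : ℕ) (hq : q + 1 ≤ n) :
    ∃ A : HodgeModel n X, A.IsSymbolNormalized q := by
  obtain ⟨A, hA, -⟩ := stub_weightOneModel hX (by omega)
  exact ⟨A, stub_powerNormalisation hX A hA q hq⟩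

/-- STUB `stub_symbolLiftR_of_primitiveLift` (registered reduction edge of item stmt-HodgeConjecture-18702, anchoring
this file for `--supports`): the open kernel S5 of line `lefschetz-fold`, stated closed and unfolded,
implies the crux `SymbolLiftR` — `symbolLiftR_of_primitiveLift`. [cite: VoisinHodgeI2002, Thm. 6.25 and Thm. 11.30] -/
theorem stub_symbolLiftR_of_primitiveLift : (∀ ⦃n : ℕ⦄ ⦃X : Motives.SchemeOver ℂ⦄, Motives.IsSmoothProjective n X → ∀ (Λ : HardLefschetzNFold n X) (A : HodgeModel n X), (∀ (k : ℕ) (y : complexDeRhamCohomology A.model A.carrier k), A.deRham A.carrier k y = ((2 * (Real.pi : ℂ) * Complex.I) ^ (k / 2))⁻¹ • (integrationDeRhamIsoFamily A.model).complexify A.carrier k y) → (∀ c : complexBetti X (2 * (0 + 1)), IsRationalClass c → IsOfHodgeType n X (2 * (0 + 1)) (0 + 1) (0 + 1) c → A.HasSymbolCocycle 0 c) → ∀ (q : ℕ), 2 * (q + 2) ≤ n → ∀ (c : complexBetti X (2 * (q + 1 + 1))), IsRationalClass c → IsOfHodgeType n X (2 * (q + 1 + 1)) (q + 1 + 1) (q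 + 1 + 1) c → (∃ (j t : ℕ) (ht : 2 * (q + 1 + 1) + 2 * j = t), 2 * (q + 1 + 1) + j = n + 1 ∧ Λ.L j (2 * (q + 1 + 1)) t ht c = 0) → A.HasSymbolCocycle (q + 1) c) → Summit.HodgeConjecture.HodgeConjecture.Theses.MilnorKExponential.SymbolLiftR :=
  fun h4 ↦ symbolLiftR_of_primitiveLift h4

end Summit.HodgeConjecture.HodgeConjecture.Theorems.SymbolLiftR

end
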